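import Mathlib.NumberTheory.NumberField.ProductFormula
import Literature.IUT.LogVolume.ExplicitEstimatesTheorem53
import HarnessLib

/-!
# [ExpEst] §1 "Heights" (Def. 1.1 – Lemma 1.3): Weil heights and toric heights on a number field — PROVED

S. Mochizuki, I. Fesenko, Y. Hoshi, A. Minamide, W. Porowski, *Explicit estimates in inter-universal
Teichmüller theory*, Kodai Math. J. **45** (2022) 175–236 — [ExpEst], bib key `MochizukiEtAl2022`. §1, p.
184–190 (pdf p10.l21 – p16.l20 of the cell render `run/shared/lean/pub/abc-iut/plan/repair/lit/renders/
MFHMP-ExplicitEstimates-Kodai2022-book-anonnd-eeiutp`; journal page = pdf page + 174). The paper itself calls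
this material "[elementary and essentially well-known] properties of heights" (Introduction p. 180); it is
CLASSICAL and independent of inter-universal Teichmüller theory (no disputed statement is involved, nothing
here is claim-tagged): every numbered statement below is a `theorem` with a proof, cited to its printed
locator. TAKES NO SIDE on [IUTchIII] Cor. 3.12; no abc claim. Cell abc-iut, seat lit-abc-explicitiut (gen 3).

These are the inputs of the printed derivations Cor. 5.2 ⟹ Thm. 5.3 ⟹ Thm. 5.4 (Claims 5.3A–C, 5.4A–C use
Lemma 1.3 (i), (iii), (iv) and Prop. 1.8 (i)); the rest of §1 (Def. 1.4 – Lemma 1.6: `ExplicitEstimatesLocalJ.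
lean`; Def. 1.7 symmetrized toric height, Props. 1.8–1.9) builds on this file; the Faltings-height part (Prop.
1.10 = [Lbr] Prop. 3.1, Lemma 1.11, Prop. 1.12, Cor. 1.14) is not typed (no Faltings height in Mathlib).

## Rendering (Mathlib's normalisations = the paper's, cf. `ExplicitEstimatesTheorem53.lean`)

* §0 "Numbers" (p. 183–184): for `v ∈ 𝕍(F)^non`, `|x|_v := ‖x‖_v^{[F_v:ℚ_{p_v}]} = N(𝔭_v)^{−ord_v(x)}` is
  Mathlib's `(w : FinitePlace F) x`; for `v ∈ 𝕍(F)^arc`, `|x|_v := ‖σ_v(x)‖_ℂ^{[F_v:ℝ]}` is `(w x)^{w.mult}` for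
  `w : InfinitePlace F`, so "`Σ_{v ∈ 𝕍(F)^arc} log g(|x|_v)`" with `g = max{·,1}` or `max{·,·^{-1}}` becomes
  `Σ_w w.mult · log g(w x)` (these `g` commute with the power `mult ∈ {1,2}`), and the product formula is
  Mathlib's `NumberField.prod_abs_eq_one`.
* Def. 1.1 (i) `h_non` is `ExpEst.hNon` (landed in `ExplicitEstimatesTheorem53.lean`); `h_arc`, `h = h_non +
  h_arc` (`height`; `= logHeight₁/[F:ℚ]`, `height_eq_logHeight₁_div`), Def. 1.1 (ii) `h^tor_non`, `h^tor_arc`,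
  `h^tor` are defined here verbatim.
* Def. 1.4 – Lemma 1.6 (the local quantities `J, J_{0∞}, J_{1∞}, J_{01}` of one absolute value) are the sibling
  file `ExplicitEstimatesLocalJ.lean` (independent of this one).
-/

noncomputable section

open scoped Classical

namespace Literature.IUT.LogVolume

namespace ExpEst

open NumberField Real

/-! ## 0. Pointwise facts about `log max{s, s⁻¹}` and `log⁺` -/

/-- `log max{s, s⁻¹} = |log s|` for `s > 0`. [folklore] -/
private theorem log_max_self_inv {s : ℝ} (hs : 0 < s) : Real.log (max s s⁻¹) = |Real.log s| := by
  rcases le_or_gt 1 s with h | h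
  · rw [max_eq_left ((inv_le_one_of_one_le₀ h).trans h), abs_of_nonneg (Real.log_nonneg h)]
  · have h' : s ≤ s⁻¹ := h.le.trans (one_le_inv_iff₀.mpr ⟨hs, h.le⟩)
    rw [max_eq_right h', Real.log_inv, abs_of_neg (Real.log_neg hs h)]

/-- `|log s| = log⁺ s + log⁺ s⁻¹` (the "easily verified fact `max{s, s⁻¹} = max{s,1}·max{s⁻¹,1}`" of the proof
of Lemma 1.3 (i), p. 185, in logarithms). [cite: MochizukiEtAl2022, Lemma 1.3 (i) proof p. 185] -/
private theorem abs_log_eq_posLog_add (s : ℝ) :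
    |Real.log s| = log⁺ s + log⁺ s⁻¹ := by
  rw [posLog_apply, posLog_apply, Real.log_inv]
  rcases le_or_gt 0 (Real.log s) with h | h
  · rw [abs_of_nonneg h, max_eq_right h, max_eq_left (by linarith), add_zero]
  · rw [abs_of_neg h, max_eq_left h.le, max_eq_right (by linarith), zero_add]

/-- `|log s| = 2·log⁺ s − log s` for `s > 0`. [folklore] -/
private theorem abs_log_eq_two_mul_posLog_sub (s : ℝ) :
    |Real.log s| = 2 * log⁺ s - Real.log s := by
  have := posLog_sub_posLog_inv (x := s)
  rw [abs_log_eq_posLog_add s]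
  linarith

/-- `log max{s, s⁻¹} ≥ 0` for `s ≥ 0`. [folklore] -/
private theorem log_max_self_inv_nonneg {s : ℝ} (hs : 0 ≤ s) : 0 ≤ Real.log (max s s⁻¹) := by
  rcases hs.eq_or_lt with h | h
  · rw [← h, inv_zero, max_self, Real.log_zero]
  · rw [log_max_self_inv h]; exact abs_nonneg _

/-! ## 1. Finite-support bookkeeping for sums over the finite places -/

variable {F : Type*} [Field F] [NumberField F]

/-- For `α ≠ 0` only finitely many finite places have `|α|_w ≠ 1` (Mathlib
`FinitePlace.hasFiniteMulSupport`): a finite set of places containing them. [folklore] -/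
private theorem exists_finset_places {α : F} (hα : α ≠ 0) :
    ∃ S : Finset (FinitePlace F), ∀ w : FinitePlace F, w α ≠ 1 → w ∈ S := by
  have hfin : (Function.mulSupport fun w : FinitePlace F => w α).Finite :=
    FinitePlace.hasFiniteMulSupport hα
  exact ⟨hfin.toFinset, fun w hw => hfin.mem_toFinset.mpr hw⟩

/-- A sum over all finite places of a function of `|α|_w` vanishing at `1` is the finite sum over any set of
places containing those with `|α|_w ≠ 1`. [folklore] -/
private theorem finsum_eq_sum_of {α : F} (S : Finset (FinitePlace F))
    (hS : ∀ w : FinitePlace F, w α ≠ 1 → w ∈ S) (G : ℝ → ℝ) (hG : G 1 = 0) :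
    ∑ᶠ w : FinitePlace F, G (w α) = ∑ w ∈ S, G (w α) := by
  apply finsum_eq_sum_of_support_subset
  intro w hw
  rw [Finset.mem_coe]
  apply hS
  intro h1
  rw [Function.mem_support, h1, hG] at hw
  exact hw rfl

/-- The finite part of the product formula as a finite product. [folklore] -/
private theorem finprod_eq_prod_of {α : F} (S : Finset (FinitePlace F))
    (hS : ∀ w : FinitePlace F, w α ≠ 1 → w ∈ S) :
    ∏ᶠ w : FinitePlace F, w α = ∏ w ∈ S, w α := by
  apply finprod_eq_prod_of_mulSupport_subset
  intro w hw
  exact Finset.mem_coe.mpr (hS w hw)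

/-- **The product formula in logarithms**: `Σ_{v ∈ 𝕍(F)} log|x|_v = 0` for `x ≠ 0`, i.e.
`Σ_{w ∣ ∞} m_w·log(w x) + Σ_{w ∤ ∞} log(w x) = 0` (Mathlib `NumberField.prod_abs_eq_one`; the paper's "product
formula", §1 passim). [cite: MochizukiEtAl2022, Lemma 1.3 (ii) proof p. 185] -/
theorem sum_mult_log_add_finsum_log {x : F} (hx : x ≠ 0) :
    (∑ w : InfinitePlace F, (w.mult : ℝ) * Real.log (w x)) +
      ∑ᶠ w : FinitePlace F, Real.log (w x) = 0 := by
  obtain ⟨S, hS⟩ := exists_finset_places hx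
  have hpf := NumberField.prod_abs_eq_one hx
  rw [finprod_eq_prod_of S hS] at hpf
  rw [finsum_eq_sum_of S hS Real.log Real.log_one]
  have h1 : ∀ w ∈ (Finset.univ : Finset (InfinitePlace F)), (w x) ^ w.mult ≠ 0 :=
    fun w _ => pow_ne_zero _ ((map_ne_zero w).mpr hx)
  have h2 : ∀ w ∈ S, w x ≠ 0 := fun w _ => (map_ne_zero w).mpr hx
  have hlog := congrArg Real.log hpf
  rw [Real.log_one, Real.log_mul (Finset.prod_ne_zero_iff.mpr h1) (Finset.prod_ne_zero_iff.mpr h2),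
    Real.log_prod h1, Real.log_prod h2] at hlog
  simpa only [Real.log_pow] using hlog

/-! ## 2. Definition 1.1: Weil heights and toric heights (p. 184) -/

/-- **[ExpEst] Def. 1.1 (i), archimedean part**: "`h_arc(α) := (1/[F:ℚ])·Σ_{v ∈ 𝕍(F)^arc} log max{|α|_v, 1}
(≥ 0)`", with `|α|_v = ‖σ_v(α)‖^{[F_v:ℝ]}`, i.e. `Σ_w w.mult·log⁺(w α)` over Mathlib's infinite places.
[cite: MochizukiEtAl2022, Def 1.1 (i) p. 184] -/
def hArc (α : F) : ℝ :=
  (Module.finrank ℚ F : ℝ)⁻¹ * ∑ w : InfinitePlace F, (w.mult : ℝ) * log⁺ (w α)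

/-- **[ExpEst] Def. 1.1 (i)**: "`h(α) := h_non(α) + h_arc(α)` … the [logarithmic] Weil height of `α`" (also
written `h_⊙(α)`); `h_non` is `ExpEst.hNon`. [cite: MochizukiEtAl2022, Def 1.1 (i) p. 184] -/
def height (α : F) : ℝ := hNon α + hArc α

/-- **[ExpEst] Def. 1.1 (ii), nonarchimedean part**: "`h^tor_non(α) := (1/(2[F:ℚ]))·Σ_{v ∈ 𝕍(F)^non} log
max{|α|_v, |α|_v^{-1}} (≥ 0)`" for `α ∈ F^×`. [cite: MochizukiEtAl2022, Def 1.1 (ii) p. 184] -/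
def hTorNon (α : F) : ℝ :=
  (2 * (Module.finrank ℚ F : ℝ))⁻¹ * ∑ᶠ w : FinitePlace F, Real.log (max (w α) (w α)⁻¹)

/-- **[ExpEst] Def. 1.1 (ii), archimedean part**: "`h^tor_arc(α) := (1/(2[F:ℚ]))·Σ_{v ∈ 𝕍(F)^arc} log
max{|α|_v, |α|_v^{-1}} (≥ 0)`" (`|α|_v = (w α)^{mult}`, so the summand is `w.mult·log max{w α, (w α)⁻¹}`).
[cite: MochizukiEtAl2022, Def 1.1 (ii) p. 184] -/
def hTorArc (α : F) : ℝ :=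
  (2 * (Module.finrank ℚ F : ℝ))⁻¹ *
    ∑ w : InfinitePlace F, (w.mult : ℝ) * Real.log (max (w α) (w α)⁻¹)

/-- **[ExpEst] Def. 1.1 (ii)**: "`h^tor(α) := h^tor_non(α) + h^tor_arc(α)` … the [logarithmic] toric height
of `α`" (also `h^tor_⊙(α)`). [cite: MochizukiEtAl2022, Def 1.1 (ii) p. 184] -/
def hTor (α : F) : ℝ := hTorNon α + hTorArc α

/-- `[F:ℚ] > 0` as a real number. [folklore] -/
private theorem finrank_pos' : (0 : ℝ) < Module.finrank ℚ F := by
  exact_mod_cast Module.finrank_pos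

/-- `h = logHeight₁/[F:ℚ]`: Def. 1.1 (i) is Mathlib's logarithmic height on the number field `F`, normalised
by the degree (Mathlib `NumberField.logHeight₁_eq`). [cite: MochizukiEtAl2022, Def 1.1 (i) p. 184] -/
theorem height_eq_logHeight₁_div (α : F) :
    height α = Height.logHeight₁ α / Module.finrank ℚ F := by
  unfold height hNon hArc
  rw [NumberField.logHeight₁_eq, div_eq_inv_mul]
  ring

/-- "(≥ 0)" in Def. 1.1 (i): `h_arc(α) ≥ 0`. [cite: MochizukiEtAl2022, Def 1.1 (i) p. 184] -/
theorem hArc_nonneg (α : F) : 0 ≤ hArc α := by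
  unfold hArc
  exact mul_nonneg (inv_nonneg.mpr (Nat.cast_nonneg _))
    (Finset.sum_nonneg fun w _ => mul_nonneg (Nat.cast_nonneg _) posLog_nonneg)

/-- `h(α) ≥ 0`. [cite: MochizukiEtAl2022, Def 1.1 (i) p. 184] -/
theorem height_nonneg (α : F) : 0 ≤ height α := add_nonneg (hNon_nonneg α) (hArc_nonneg α)

/-- "(≥ 0)" in Def. 1.1 (ii): `h^tor_non(α) ≥ 0`. [cite: MochizukiEtAl2022, Def 1.1 (ii) p. 184] -/
theorem hTorNon_nonneg (α : F) : 0 ≤ hTorNon α := by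
  unfold hTorNon
  exact mul_nonneg (inv_nonneg.mpr (by positivity))
    (finsum_nonneg fun w => log_max_self_inv_nonneg (apply_nonneg w α))

/-- "(≥ 0)" in Def. 1.1 (ii): `h^tor_arc(α) ≥ 0`. [cite: MochizukiEtAl2022, Def 1.1 (ii) p. 184] -/
theorem hTorArc_nonneg (α : F) : 0 ≤ hTorArc α := by
  unfold hTorArc
  exact mul_nonneg (inv_nonneg.mpr (by positivity))
    (Finset.sum_nonneg fun w _ =>
      mul_nonneg (Nat.cast_nonneg _) (log_max_self_inv_nonneg (apply_nonneg w α)))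

/-- `h^tor(α) ≥ 0`. [cite: MochizukiEtAl2022, Def 1.1 (ii) p. 184] -/
theorem hTor_nonneg (α : F) : 0 ≤ hTor α := add_nonneg (hTorNon_nonneg α) (hTorArc_nonneg α)

/-! ## 3. Lemma 1.3 (Properties of toric heights), p. 185 -/

/-- **[ExpEst] Lemma 1.3 (i), first equality, `□ = non`**: "`h^tor_□(α) = h^tor_□(α^{-1})`".
[cite: MochizukiEtAl2022, Lemma 1.3 (i) p. 185] -/
theorem hTorNon_inv (α : F) : hTorNon α⁻¹ = hTorNon α := by
  unfold hTorNon
  congr 1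
  refine finsum_congr fun w => ?_
  rw [map_inv₀, inv_inv, max_comm]

/-- **[ExpEst] Lemma 1.3 (i), first equality, `□ = arc`**. [cite: MochizukiEtAl2022, Lemma 1.3 (i) p. 185] -/
theorem hTorArc_inv (α : F) : hTorArc α⁻¹ = hTorArc α := by
  unfold hTorArc
  congr 1
  refine Finset.sum_congr rfl fun w _ => ?_
  rw [map_inv₀, inv_inv, max_comm]

/-- **[ExpEst] Lemma 1.3 (i), first equality, `□ = ⊙`**: "`h^tor(α) = h^tor(α^{-1})`".
[cite: MochizukiEtAl2022, Lemma 1.3 (i) p. 185] -/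
theorem hTor_inv (α : F) : hTor α⁻¹ = hTor α := by
  unfold hTor; rw [hTorNon_inv, hTorArc_inv]

/-- **[ExpEst] Lemma 1.3 (i), second equality, `□ = non`**: "`h^tor_□(α) = ½·{h_□(α) + h_□(α^{-1})}`" for
`α ∈ F^×`. [cite: MochizukiEtAl2022, Lemma 1.3 (i) p. 185] -/
theorem hTorNon_eq_half (α : F) (hα : α ≠ 0) : hTorNon α = (hNon α + hNon α⁻¹) / 2 := by
  obtain ⟨S, hS⟩ := exists_finset_places hα
  have hS' : ∀ w : FinitePlace F, w α⁻¹ ≠ 1 → w ∈ S := by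
    intro w hw; apply hS; rwa [map_inv₀, ne_eq, inv_eq_one] at hw
  unfold hTorNon hNon
  rw [finsum_eq_sum_of S hS (fun s => Real.log (max s s⁻¹)) (by simp),
    finsum_eq_sum_of S hS (fun s => log⁺ s) posLog_one,
    finsum_eq_sum_of S hS' (fun s => log⁺ s) posLog_one]
  have hpt : ∀ w ∈ S, Real.log (max (w α) (w α)⁻¹) = log⁺ (w α) + log⁺ (w α⁻¹) := by
    intro w _
    rw [map_inv₀, log_max_self_inv (FinitePlace.pos_iff.mpr hα),
      abs_log_eq_posLog_add _]
  rw [Finset.sum_congr rfl hpt, Finset.sum_add_distrib]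
  have hd := finrank_pos' (F := F)
  field_simp

/-- **[ExpEst] Lemma 1.3 (i), second equality, `□ = arc`**. [cite: MochizukiEtAl2022, Lemma 1.3 (i) p. 185] -/
theorem hTorArc_eq_half (α : F) (hα : α ≠ 0) : hTorArc α = (hArc α + hArc α⁻¹) / 2 := by
  unfold hTorArc hArc
  have hpt : ∀ w ∈ (Finset.univ : Finset (InfinitePlace F)),
      (w.mult : ℝ) * Real.log (max (w α) (w α)⁻¹) =
        (w.mult : ℝ) * log⁺ (w α) + (w.mult : ℝ) * log⁺ (w α⁻¹) := by
    intro w _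
    rw [map_inv₀, log_max_self_inv (InfinitePlace.pos_iff.mpr hα),
      abs_log_eq_posLog_add _]
    ring
  rw [Finset.sum_congr rfl hpt, Finset.sum_add_distrib]
  have hd := finrank_pos' (F := F)
  field_simp

/-- **[ExpEst] Lemma 1.3 (i), second equality, `□ = ⊙`**: "`h^tor(α) = ½·{h(α) + h(α^{-1})}`".
[cite: MochizukiEtAl2022, Lemma 1.3 (i) p. 185] -/
theorem hTor_eq_half (α : F) (hα : α ≠ 0) : hTor α = (height α + height α⁻¹) / 2 := by
  unfold hTor height
  rw [hTorNon_eq_half α hα, hTorArc_eq_half α hα]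
  ring

/-- **[ExpEst] Lemma 1.3 (ii)**: "`h(α) = h^tor(α)`" for `α ∈ F^×` — by the product formula ("`2d·h^tor(α) =
Σ_v log max{|α|_v, |α|_v^{-1}} = 2d·h(α) + Σ_v log|α|_v^{-1} = 2d·h(α)`", p. 185).
[cite: MochizukiEtAl2022, Lemma 1.3 (ii) p. 185] -/
theorem height_eq_hTor (α : F) (hα : α ≠ 0) : height α = hTor α := by
  obtain ⟨S, hS⟩ := exists_finset_places hα
  have hpf := sum_mult_log_add_finsum_log hα
  rw [finsum_eq_sum_of S hS Real.log Real.log_one] at hpf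
  unfold hTor hTorNon hTorArc height hNon hArc
  rw [finsum_eq_sum_of S hS (fun s => Real.log (max s s⁻¹)) (by simp),
    finsum_eq_sum_of S hS (fun s => log⁺ s) posLog_one]
  have hpt : ∀ w ∈ S, Real.log (max (w α) (w α)⁻¹) = 2 * log⁺ (w α) - Real.log (w α) := by
    intro w _
    rw [log_max_self_inv (FinitePlace.pos_iff.mpr hα),
      abs_log_eq_two_mul_posLog_sub _]
  have hpt' : ∀ w ∈ (Finset.univ : Finset (InfinitePlace F)),
      (w.mult : ℝ) * Real.log (max (w α) (w α)⁻¹) =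
        2 * ((w.mult : ℝ) * log⁺ (w α)) - (w.mult : ℝ) * Real.log (w α) := by
    intro w _
    rw [log_max_self_inv (InfinitePlace.pos_iff.mpr hα),
      abs_log_eq_two_mul_posLog_sub _]
    ring
  have e1 : ∑ w ∈ S, Real.log (max (w α) (w α)⁻¹) =
      2 * ∑ w ∈ S, log⁺ (w α) - ∑ w ∈ S, Real.log (w α) := by
    rw [Finset.mul_sum, ← Finset.sum_sub_distrib]; exact Finset.sum_congr rfl hpt
  have e2 : ∑ w : InfinitePlace F, (w.mult : ℝ) * Real.log (max (w α) (w α)⁻¹) =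
      2 * ∑ w : InfinitePlace F, (w.mult : ℝ) * log⁺ (w α) -
        ∑ w : InfinitePlace F, (w.mult : ℝ) * Real.log (w α) := by
    rw [Finset.mul_sum, ← Finset.sum_sub_distrib]; exact Finset.sum_congr rfl hpt'
  rw [e1, e2]
  have hd := finrank_pos' (F := F)
  field_simp
  linarith

/-- **[ExpEst] Lemma 1.3 (ii), "in particular"**: "`h(α) = h(α^{-1})`".
[cite: MochizukiEtAl2022, Lemma 1.3 (ii) p. 185] -/
theorem height_inv (α : F) : height α⁻¹ = height α := by
  by_cases hα : α = 0
  · rw [hα, inv_zero]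
  · rw [height_eq_hTor α hα, height_eq_hTor α⁻¹ (inv_ne_zero hα), hTor_inv]

/-- **[ExpEst] Lemma 1.3 (iii)**: "Suppose that `F` is mono-complex. Then we have `h^tor_arc(α) ≤
h^tor_non(α)`" for `α ∈ F^×` — the product formula at the unique archimedean place: for `|α|_w ≥ 1`,
`2d·h^tor_arc(α) = log|α|_w = Σ_{v ∤ ∞} log|α|_v^{-1} ≤ Σ_{v ∤ ∞} log max{|α|_v, |α|_v^{-1}} = 2d·h^tor_non(α)`,
and the case `|α|_w < 1` follows by `α ↦ α^{-1}` (Lemma 1.3 (i)) (p. 186). (Remark 1.3.1: the Weil height does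
NOT have this property.) [cite: MochizukiEtAl2022, Lemma 1.3 (iii) p. 185–186] -/
theorem hTorArc_le_hTorNon (hF : IsMonoComplex F) (α : F) (hα : α ≠ 0) : hTorArc α ≤ hTorNon α := by
  -- the unique archimedean place
  obtain ⟨w₀, hw₀⟩ := Fintype.card_eq_one_iff.mp hF
  -- the case `|β|_{w₀} ≥ 1`
  have key : ∀ β : F, β ≠ 0 → 1 ≤ w₀ β → hTorArc β ≤ hTorNon β := by
    intro β hβ h1
    obtain ⟨S, hS⟩ := exists_finset_places hβ
    have hpf := sum_mult_log_add_finsum_log hβ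
    rw [finsum_eq_sum_of S hS Real.log Real.log_one,
      Fintype.sum_eq_single w₀ (fun w hw => absurd (hw₀ w) hw)] at hpf
    unfold hTorArc hTorNon
    rw [finsum_eq_sum_of S hS (fun s => Real.log (max s s⁻¹)) (by simp),
      Fintype.sum_eq_single w₀ (fun w hw => absurd (hw₀ w) hw),
      max_eq_left ((inv_le_one_of_one_le₀ h1).trans h1)]
    have hle : -(∑ w ∈ S, Real.log (w β)) ≤ ∑ w ∈ S, Real.log (max (w β) (w β)⁻¹) := by
      rw [← Finset.sum_neg_distrib]
      refine Finset.sum_le_sum fun w _ => ?_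
      rw [← Real.log_inv]
      exact Real.log_le_log (inv_pos.mpr (FinitePlace.pos_iff.mpr hβ)) (le_max_right _ _)
    have heq : (w₀.mult : ℝ) * Real.log (w₀ β) = -(∑ w ∈ S, Real.log (w β)) := by linarith
    rw [heq]
    exact mul_le_mul_of_nonneg_left hle (inv_nonneg.mpr (by positivity))
  rcases le_or_gt 1 (w₀ α) with h | h
  · exact key α hα h
  · have h' : 1 ≤ w₀ α⁻¹ := by
      rw [map_inv₀]; exact one_le_inv_iff₀.mpr ⟨InfinitePlace.pos_iff.mpr hα, h.le⟩
    rw [← hTorArc_inv α, ← hTorNon_inv α]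
    exact key α⁻¹ (inv_ne_zero hα) h'

/-- **[ExpEst] Lemma 1.3 (iv), first inequality, `□ = non`**: "`h_□(x) + h_□(y) ≥ h_□(x·y)`" for `x, y ∈ F`
("`max{st, 1} ≤ max{s, 1}·max{t, 1}`", p. 186). [cite: MochizukiEtAl2022, Lemma 1.3 (iv) p. 185–186] -/
theorem hNon_mul_le (x y : F) : hNon (x * y) ≤ hNon x + hNon y := by
  have h0 : hNon (0 : F) = 0 := by simp [hNon]
  by_cases hx : x = 0
  · rw [hx, zero_mul, h0, zero_add]; exact hNon_nonneg y
  by_cases hy : y = 0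
  · rw [hy, mul_zero, h0, add_zero]; exact hNon_nonneg x
  obtain ⟨Sx, hSx⟩ := exists_finset_places hx
  obtain ⟨Sy, hSy⟩ := exists_finset_places hy
  have hS1 : ∀ w : FinitePlace F, w x ≠ 1 → w ∈ Sx ∪ Sy :=
    fun w hw => Finset.mem_union_left _ (hSx w hw)
  have hS2 : ∀ w : FinitePlace F, w y ≠ 1 → w ∈ Sx ∪ Sy :=
    fun w hw => Finset.mem_union_right _ (hSy w hw)
  have hS3 : ∀ w : FinitePlace F, w (x * y) ≠ 1 → w ∈ Sx ∪ Sy := by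
    intro w hw
    by_cases h1 : w x = 1
    · apply hS2; rwa [map_mul, h1, one_mul] at hw
    · exact hS1 w h1
  unfold hNon
  rw [finsum_eq_sum_of _ hS1 (fun s => log⁺ s) posLog_one,
    finsum_eq_sum_of _ hS2 (fun s => log⁺ s) posLog_one,
    finsum_eq_sum_of _ hS3 (fun s => log⁺ s) posLog_one, ← mul_add, ← Finset.sum_add_distrib]
  refine mul_le_mul_of_nonneg_left (Finset.sum_le_sum fun w _ => ?_)
    (inv_nonneg.mpr (Nat.cast_nonneg _))
  rw [map_mul]
  exact posLog_mul

/-- **[ExpEst] Lemma 1.3 (iv), first inequality, `□ = arc`**. [cite: MochizukiEtAl2022, Lemma 1.3 (iv) p. 185–186] -/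
theorem hArc_mul_le (x y : F) : hArc (x * y) ≤ hArc x + hArc y := by
  unfold hArc
  rw [← mul_add, ← Finset.sum_add_distrib]
  refine mul_le_mul_of_nonneg_left (Finset.sum_le_sum fun w _ => ?_)
    (inv_nonneg.mpr (Nat.cast_nonneg _))
  rw [map_mul, ← mul_add]
  exact mul_le_mul_of_nonneg_left posLog_mul (Nat.cast_nonneg _)

/-- **[ExpEst] Lemma 1.3 (iv), first inequality, `□ = ⊙`**: "`h(x) + h(y) ≥ h(x·y)`".
[cite: MochizukiEtAl2022, Lemma 1.3 (iv) p. 185–186] -/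
theorem height_mul_le (x y : F) : height (x * y) ≤ height x + height y := by
  unfold height; have := hNon_mul_le x y; have := hArc_mul_le x y; linarith

/-- **[ExpEst] Lemma 1.3 (iv), second inequality, `□ = non`**: "`h^tor_□(x^tor) + h^tor_□(y^tor) ≥
h^tor_□(x^tor·y^tor)`" for `x^tor, y^tor ∈ F^×` (from the first inequality via Lemma 1.3 (i), as in print).
[cite: MochizukiEtAl2022, Lemma 1.3 (iv) p. 185–186] -/
theorem hTorNon_mul_le (x y : F) (hx : x ≠ 0) (hy : y ≠ 0) :
    hTorNon (x * y) ≤ hTorNon x + hTorNon y := by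
  rw [hTorNon_eq_half _ (mul_ne_zero hx hy), hTorNon_eq_half x hx, hTorNon_eq_half y hy, mul_inv]
  have h1 := hNon_mul_le x y
  have h2 := hNon_mul_le x⁻¹ y⁻¹
  linarith

/-- **[ExpEst] Lemma 1.3 (iv), second inequality, `□ = arc`**. [cite: MochizukiEtAl2022, Lemma 1.3 (iv) p. 185–186] -/
theorem hTorArc_mul_le (x y : F) (hx : x ≠ 0) (hy : y ≠ 0) :
    hTorArc (x * y) ≤ hTorArc x + hTorArc y := by
  rw [hTorArc_eq_half _ (mul_ne_zero hx hy), hTorArc_eq_half x hx, hTorArc_eq_half y hy, mul_inv]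
  have h1 := hArc_mul_le x y
  have h2 := hArc_mul_le x⁻¹ y⁻¹
  linarith

/-- **[ExpEst] Lemma 1.3 (iv), second inequality, `□ = ⊙`**. [cite: MochizukiEtAl2022, Lemma 1.3 (iv) p. 185–186] -/
theorem hTor_mul_le (x y : F) (hx : x ≠ 0) (hy : y ≠ 0) : hTor (x * y) ≤ hTor x + hTor y := by
  unfold hTor; have := hTorNon_mul_le x y hx hy; have := hTorArc_mul_le x y hx hy; linarith

end ExpEst

end Literature.IUT.LogVolume

end
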